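import Mathlib
import Summits.NavierStokesRegularity.NavierStokesRegularity.Theorems.EulerZoomLiouvillePowerGaugeEulerLiouvillePowerClockFiniteEnergy
import Summits.NavierStokesRegularity.NavierStokesRegularity.Theorems.EulerZoomLiouvillePowerGaugeEulerLiouvilleFluxWindow
import HarnessLib

/-!
# DISCRETE CLOCKS — tools: the orbit of one Euler scaling and the `A`-gauge read along it
# (crux `EulerZoomLiouville.PowerGaugeEulerLiouville` = stmt-NavierStokesRegularity-19832; line `logtime-breathers` of ns-idea-11; sequel file
# `…DiscreteClock` carries the member-level strata)

Route `EulerZoomLiouville` (NavierStokesRegularity); width seat ns-ezl-w4 g2.  A member is a DISCRETE CLOCK of rate `g` with factor `T > 1` if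
`u(τ, y) = T^{1−g} · u(Tτ, T^{g} y)` for all `τ < 0` and all `y` (invariance under ONE of Euler's scalings `(τ, y, u) ↦ (Tτ, T^{g}y, T^{g−1}u)`;
the tree's DSS is the class rate `g = 1/(2+ρ)`).  This file: the orbit identities (`iterate`, `slice_earlier`, `slice_later`), the clock factors of
the ball energies (`clockFactor_eq`, `clockFactor_inv_eq`), and the two PROFILE-FREE `A`-gauge readings along the orbit —

* `lintegral_ball_slice_eq_zero_of_fast` — `0 ≤ ρ ≤ ½`, `g > ½ − ρ/5`: every slice has zero energy on every ball (read at the times `Tⁿτ → −∞` on the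
  balls `K T^{n·max(g,½)}`; rate `2 − 5g + max(g,½)(1−2ρ) < 0`);
* `lintegral_ball_slice_eq_zero_of_slow` — `ρ ≥ 0`, `g < 1/(2+ρ)`: every slice has zero energy on every ball (read at the LATER times `T^{−n}τ → 0⁻` on the
  balls `T^{−gn}R`; rate `g(4+2ρ) − 2 < 0`);
* `lintegral_eq_zero_of_forall_ball` — whole-space lower integral from the balls `B_{n+1}`.

WHAT THIS IS NOT: not NS, not E — helper lemmas for strata of the crux CLASS 19832 on the MODEL lattice, `--supports` stmt-19832.
[folklore; line card `Cruxes/PowerGaugeEulerLiouville/Lines/logtime-breathers.md` T4/T5]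
-/

noncomputable section

-- flat `Theorems/<Route><Decl>…` files of one crux share the namespace of the crux (tree convention: `Summit.<S>.<S>.…`)
set_option linter.dupNamespace false

open MeasureTheory Set Filter Topology Metric Function TopologicalSpace Module
open scoped ENNReal NNReal

namespace Summit.NavierStokesRegularity.NavierStokesRegularity.Theorems.PowerGaugeEulerLiouville

open Literature.Analysis Literature.Analysis.FunctionSpaces Literature.Analysis.FluidPDE

namespace DiscreteClock

variable {u : ℝ → EuclideanSpace ℝ (Fin 3) → EuclideanSpace ℝ (Fin 3)} {c : ℝ≥0} {T g : ℝ}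

/-! ### The orbit of the group element -/

/-- **Iteration of the discrete clock symmetry**: `u(τ, y) = T^{(1−g)n} u(Tⁿτ, T^{gn} y)` for `τ < 0` (`T > 0`). [folklore] -/
theorem iterate (hT : 0 < T)
    (h : ∀ τ : ℝ, τ < 0 → ∀ y, u τ y = T ^ (1 - g) • u (T * τ) (T ^ g • y)) :
    ∀ n : ℕ, ∀ τ : ℝ, τ < 0 → ∀ y, u τ y = T ^ ((1 - g) * n) • u (T ^ n * τ) (T ^ (g * n) • y) := by
  intro n
  induction n with
  | zero => intro τ hτ y; simp
  | succ n ih =>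
    intro τ hτ y
    have hτn : T ^ n * τ < 0 := mul_neg_of_pos_of_neg (pow_pos hT n) hτ
    rw [ih τ hτ y, h (T ^ n * τ) hτn (T ^ (g * n) • y), smul_smul, smul_smul]
    have e1 : T ^ ((1 - g) * n) * T ^ (1 - g) = T ^ ((1 - g) * ((n + 1 : ℕ) : ℝ)) := by
      rw [← Real.rpow_add hT]; congr 1; push_cast; ring
    have e2 : T * (T ^ n * τ) = T ^ (n + 1) * τ := by rw [pow_succ]; ring
    have e3 : T ^ g * T ^ (g * n) = T ^ (g * ((n + 1 : ℕ) : ℝ)) := by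
      rw [← Real.rpow_add hT]; congr 1; push_cast; ring
    rw [e1, e2, e3]

/-- The EARLIER slice along the orbit: `u(Tⁿτ, x) = T^{−(1−g)n} u(τ, T^{−gn} x)` (`τ < 0`). [folklore] -/
theorem slice_earlier (hT : 0 < T)
    (h : ∀ τ : ℝ, τ < 0 → ∀ y, u τ y = T ^ (1 - g) • u (T * τ) (T ^ g • y))
    (n : ℕ) {τ : ℝ} (hτ : τ < 0) (x : EuclideanSpace ℝ (Fin 3)) :
    u (T ^ n * τ) x = (T ^ ((1 - g) * n))⁻¹ • u τ ((T ^ (g * n))⁻¹ • x) := by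
  have hθ : T ^ ((1 - g) * n) ≠ 0 := (Real.rpow_pos_of_pos hT _).ne'
  have hℓ : T ^ (g * n) ≠ 0 := (Real.rpow_pos_of_pos hT _).ne'
  have hit := iterate hT h n τ hτ ((T ^ (g * n))⁻¹ • x)
  rw [smul_smul, mul_inv_cancel₀ hℓ, one_smul] at hit
  rw [hit, smul_smul, inv_mul_cancel₀ hθ, one_smul]

/-- The LATER slice along the orbit: `u(T^{−n}τ, y) = T^{(1−g)n} u(τ, T^{gn} y)` (`τ < 0`). [folklore] -/
theorem slice_later (hT : 0 < T)
    (h : ∀ τ : ℝ, τ < 0 → ∀ y, u τ y = T ^ (1 - g) • u (T * τ) (T ^ g • y))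
    (n : ℕ) {τ : ℝ} (hτ : τ < 0) (y : EuclideanSpace ℝ (Fin 3)) :
    u ((T ^ n)⁻¹ * τ) y = T ^ ((1 - g) * n) • u τ (T ^ (g * n) • y) := by
  have hTn : 0 < T ^ n := pow_pos hT n
  have hs : (T ^ n)⁻¹ * τ < 0 := mul_neg_of_pos_of_neg (inv_pos.2 hTn) hτ
  rw [iterate hT h n _ hs y, mul_inv_cancel_left₀ hTn.ne']

/-- The clock factor of the ball energies: `(T^{(1−g)n})² (T^{−gn})³ = T^{(2−5g)n}`. [folklore] -/
theorem clockFactor_eq (hT : 0 < T) (n : ℕ) :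
    (T ^ ((1 - g) * n)) ^ 2 * ((T ^ (g * n))⁻¹) ^ 3 = T ^ ((2 - 5 * g) * n) := by
  rw [← Real.rpow_neg hT.le, ← Real.rpow_natCast (T ^ ((1 - g) * n)) 2, ← Real.rpow_natCast (T ^ (-(g * n))) 3,
    ← Real.rpow_mul hT.le, ← Real.rpow_mul hT.le, ← Real.rpow_add hT]
  congr 1
  push_cast
  ring

/-- The inverse clock factor: `(T^{−(1−g)n})² (T^{gn})³ = T^{(5g−2)n}`. [folklore] -/
theorem clockFactor_inv_eq (hT : 0 < T) (n : ℕ) :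
    ((T ^ ((1 - g) * n))⁻¹) ^ 2 * (T ^ (g * n)) ^ 3 = T ^ ((5 * g - 2) * n) := by
  rw [← Real.rpow_neg hT.le, ← Real.rpow_natCast (T ^ (-((1 - g) * n))) 2, ← Real.rpow_natCast (T ^ (g * n)) 3,
    ← Real.rpow_mul hT.le, ← Real.rpow_mul hT.le, ← Real.rpow_add hT]
  congr 1
  push_cast
  ring

/-- Powers of `T > 1` with a negative rate tend to zero along the integers: `T^{e n} → 0` (`e < 0`). [folklore] -/
theorem tendsto_rpow_mul_natCast_of_neg (hT : 1 < T) {e : ℝ} (he : e < 0) :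
    Tendsto (fun n : ℕ => T ^ (e * n)) atTop (𝓝 0) := by
  have h := tendsto_pow_atTop_nhds_zero_of_lt_one (Real.rpow_nonneg (zero_le_one.trans hT.le) e)
    (Real.rpow_lt_one_of_one_lt_of_neg hT he)
  refine h.congr fun n => ?_
  rw [Real.rpow_mul_natCast (zero_le_one.trans hT.le)]

/-! ### Fast discrete clocks: every slice is zero -/

/-- **FAST DISCRETE CLOCKS have zero slices on every ball** (`0 ≤ ρ ≤ ½`, `T > 1`, `g > ½ − ρ/5`, the `A`-gauge): at the time `Tⁿτ` and radius
`a = K T^{mn}`, `m = max(g, ½)`, `K = R + 2√(−τ) + 1` (admissible: `a ≥ T^{gn}R`, `a² ≥ K²Tⁿ > (−τ)Tⁿ`) the gauge reads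
`∫_{B_R}|u(τ)|² = T^{(2−5g)n}∫_{B_{T^{gn}R}}|u(Tⁿτ)|² ≤ c K^{1−2ρ} T^{n(2 − 5g + m(1−2ρ))} → 0`. [folklore] -/
theorem lintegral_ball_slice_eq_zero_of_fast {ρ : ℝ} (hρ : 0 ≤ ρ) (hρh : ρ ≤ 1 / 2)
    (hA : ∀ a : ℝ, 0 < a → ENNReal.ofReal (a ^ (2 * ρ)) *
      cknA a (0 : ℝ × EuclideanSpace ℝ (Fin 3)) u ≤ (c : ℝ≥0∞))
    (hT : 1 < T) (hg : 1 / 2 - ρ / 5 < g)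
    (h : ∀ τ : ℝ, τ < 0 → ∀ y, u τ y = T ^ (1 - g) • u (T * τ) (T ^ g • y))
    {τ : ℝ} (hτ : τ < 0) {R : ℝ} (hR : 0 < R) :
    ∫⁻ y in ball (0 : EuclideanSpace ℝ (Fin 3)) R, ‖u τ y‖ₑ ^ 2 = 0 := by
  have hT0 : 0 < T := zero_lt_one.trans hT
  have hT1 : (1 : ℝ) ≤ T := hT.le
  have hS := hasScaledLocalEnergyBound_of_gaugeA hA
  set s : ℝ := 1 - 2 * ρ with hs
  have hs0 : 0 ≤ s := by rw [hs]; linarith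
  set m : ℝ := max g (1 / 2) with hm
  have hmg : g ≤ m := le_max_left _ _
  have hmh : 1 / 2 ≤ m := le_max_right _ _
  -- the rate
  set e : ℝ := 2 - 5 * g + m * s with he
  have he0 : e < 0 := by
    rcases le_or_gt g (1 / 2) with hgl | hgl
    · have hm' : m = 1 / 2 := max_eq_right hgl
      rw [he, hm', hs]; nlinarith
    · have hm' : m = g := max_eq_left hgl.le
      rw [he, hm', hs]; nlinarith
  set K : ℝ := R + 2 * Real.sqrt (-τ) + 1 with hK
  have hK0 : 0 < K := by have := Real.sqrt_nonneg (-τ); rw [hK]; linarith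
  have hKR : R ≤ K := by have := Real.sqrt_nonneg (-τ); rw [hK]; linarith
  set J : ℝ≥0∞ := ∫⁻ y in ball (0 : EuclideanSpace ℝ (Fin 3)) R, ‖u τ y‖ₑ ^ 2 with hJ
  -- ### the bound along the orbit
  have hbound : ∀ n : ℕ, J ≤ ENNReal.ofReal ((c : ℝ) * K ^ s * T ^ (e * n)) := by
    intro n
    have hθ : 0 < T ^ ((1 - g) * n) := Real.rpow_pos_of_pos hT0 _
    have hℓ : 0 < T ^ (g * n) := Real.rpow_pos_of_pos hT0 _
    set t : ℝ := T ^ n * τ with ht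
    have ht0 : t < 0 := mul_neg_of_pos_of_neg (pow_pos hT0 n) hτ
    set a : ℝ := K * T ^ (m * n) with ha
    have hTm : 0 < T ^ (m * n) := Real.rpow_pos_of_pos hT0 _
    have ha0 : 0 < a := mul_pos hK0 hTm
    -- admissibility: `a² ≥ K² Tⁿ > (−τ) Tⁿ`
    have hmem : t ∈ Ioo (-(a ^ 2)) 0 := by
      refine ⟨?_, ht0⟩
      have h1 : (T : ℝ) ^ (n : ℝ) ≤ T ^ (2 * (m * n)) :=
        Real.rpow_le_rpow_of_exponent_le hT1 (by nlinarith [Nat.cast_nonneg (α := ℝ) n])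
      rw [Real.rpow_natCast] at h1
      have h2 : (T ^ (m * n)) ^ 2 = T ^ (2 * (m * n)) := by
        rw [← Real.rpow_natCast (T ^ (m * n)) 2, ← Real.rpow_mul hT0.le]; congr 1; push_cast; ring
      have hK2 : -τ < K ^ 2 := by
        have hsq : Real.sqrt (-τ) ^ 2 = -τ := Real.sq_sqrt (by linarith)
        have hs0 : 0 ≤ Real.sqrt (-τ) := Real.sqrt_nonneg _
        have hsK : Real.sqrt (-τ) < K := by rw [hK]; linarith
        have := pow_lt_pow_left₀ hsK hs0 two_ne_zero
        rwa [hsq] at this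
      have h3 : -τ * T ^ n < a ^ 2 := by
        rw [ha, mul_pow, h2]
        have hTn : 0 < (T : ℝ) ^ n := pow_pos hT0 n
        calc -τ * T ^ n < K ^ 2 * T ^ n := mul_lt_mul_of_pos_right hK2 hTn
          _ ≤ K ^ 2 * T ^ (2 * (m * n)) := mul_le_mul_of_nonneg_left h1 (sq_nonneg K)
      have h4 : -τ * T ^ n = -(T ^ n * τ) := by ring
      rw [ht]; linarith
    -- `T^{gn} R ≤ a`
    have hRa : T ^ (g * n) * R ≤ a := by
      rw [ha, mul_comm K]
      exact mul_le_mul (Real.rpow_le_rpow_of_exponent_le hT1 (by nlinarith [Nat.cast_nonneg (α := ℝ) n]))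
        hKR hR.le hTm.le
    -- the slice `u τ` on `B_R` is a rescaling of `u t` on `B_{T^{gn} R}`
    have hfun : (fun y => ‖u τ y‖ₑ ^ 2) =
        fun y => ‖T ^ ((1 - g) * n) • u t (((T ^ (g * n))⁻¹)⁻¹ • y)‖ₑ ^ 2 := by
      funext y; rw [inv_inv, ht, iterate hT0 h n τ hτ y]
    have hJeq : J = ENNReal.ofReal (T ^ ((2 - 5 * g) * n)) *
        ∫⁻ z in ball (0 : EuclideanSpace ℝ (Fin 3)) (T ^ (g * n) * R), ‖u t z‖ₑ ^ 2 := by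
      rw [hJ, hfun, PastShape.lintegral_ball_shape (inv_pos.2 hℓ) (u t) R, inv_inv, clockFactor_eq hT0]
    have hmono : ∫⁻ z in ball (0 : EuclideanSpace ℝ (Fin 3)) (T ^ (g * n) * R), ‖u t z‖ₑ ^ 2 ≤
        ∫⁻ z in ball (0 : EuclideanSpace ℝ (Fin 3)) a, ‖u t z‖ₑ ^ 2 :=
      lintegral_mono_set (ball_subset_ball hRa)
    have hgauge : ∫⁻ z in ball (0 : EuclideanSpace ℝ (Fin 3)) a, ‖u t z‖ₑ ^ 2 ≤ ENNReal.ofReal (c * a ^ s) :=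
      hS a ha0 t hmem
    have has : a ^ s = K ^ s * T ^ (m * n * s) := by
      rw [ha, Real.mul_rpow hK0.le hTm.le, ← Real.rpow_mul hT0.le]
    calc J = ENNReal.ofReal (T ^ ((2 - 5 * g) * n)) *
          ∫⁻ z in ball (0 : EuclideanSpace ℝ (Fin 3)) (T ^ (g * n) * R), ‖u t z‖ₑ ^ 2 := hJeq
      _ ≤ ENNReal.ofReal (T ^ ((2 - 5 * g) * n)) * ENNReal.ofReal (c * a ^ s) := by gcongr; exact hmono.trans hgauge
      _ = ENNReal.ofReal ((c : ℝ) * K ^ s * T ^ (e * n)) := by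
          rw [← ENNReal.ofReal_mul (Real.rpow_nonneg hT0.le _), has]
          congr 1
          have : T ^ ((2 - 5 * g) * n) * T ^ (m * n * s) = T ^ (e * n) := by
            rw [← Real.rpow_add hT0]; congr 1; rw [he]; ring
          calc T ^ ((2 - 5 * g) * n) * (c * (K ^ s * T ^ (m * n * s)))
              = c * K ^ s * (T ^ ((2 - 5 * g) * n) * T ^ (m * n * s)) := by ring
            _ = c * K ^ s * T ^ (e * n) := by rw [this]
  -- ### `n → ∞`
  have hlim : Tendsto (fun n : ℕ => ENNReal.ofReal ((c : ℝ) * K ^ s * T ^ (e * n))) atTop (𝓝 0) := by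
    have h1 := (tendsto_rpow_mul_natCast_of_neg hT he0).const_mul ((c : ℝ) * K ^ s)
    rw [mul_zero] at h1
    have h2 := ENNReal.tendsto_ofReal h1
    rwa [ENNReal.ofReal_zero] at h2
  exact le_antisymm (ge_of_tendsto hlim (Eventually.of_forall hbound)) bot_le

/-! ### Slow discrete clocks (`g < 1/(2+ρ)`): every slice is zero, read at the later times `T^{−n}τ → 0⁻` -/

/-- **SLOW DISCRETE CLOCKS have zero slices on every ball** (`ρ ≥ 0`, `T > 1`, `g < 1/(2+ρ)`, the `A`-gauge): at the LATER time `T^{−n}τ` on the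
ball of radius `T^{−gn}R` (admissible once `R² T^{n(1−2g)} > −τ`) the gauge reads `T^{(2−5g)n}∫_{B_R}|u(τ)|² ≤ c (T^{−gn}R)^{1−2ρ}`, i.e.
`∫_{B_R}|u(τ)|² ≤ c R^{1−2ρ} T^{n(g(4+2ρ)−2)} → 0`. [folklore] -/
theorem lintegral_ball_slice_eq_zero_of_slow {ρ : ℝ} (hρ : 0 ≤ ρ)
    (hA : ∀ a : ℝ, 0 < a → ENNReal.ofReal (a ^ (2 * ρ)) *
      cknA a (0 : ℝ × EuclideanSpace ℝ (Fin 3)) u ≤ (c : ℝ≥0∞))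
    (hT : 1 < T) (hg : g < 1 / (2 + ρ))
    (h : ∀ τ : ℝ, τ < 0 → ∀ y, u τ y = T ^ (1 - g) • u (T * τ) (T ^ g • y))
    {τ : ℝ} (hτ : τ < 0) {R : ℝ} (hR : 0 < R) :
    ∫⁻ y in ball (0 : EuclideanSpace ℝ (Fin 3)) R, ‖u τ y‖ₑ ^ 2 = 0 := by
  have hT0 : 0 < T := zero_lt_one.trans hT
  have hS := hasScaledLocalEnergyBound_of_gaugeA hA
  have h2ρ : (0 : ℝ) < 2 + ρ := by linarith
  have hg2 : g < 1 / 2 := lt_of_lt_of_le hg (one_div_le_one_div_of_le two_pos (by linarith))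
  have hg4 : g * (4 + 2 * ρ) < 2 := by
    have := (lt_div_iff₀ h2ρ).1 hg
    nlinarith
  set s : ℝ := 1 - 2 * ρ with hs
  set e : ℝ := g * (4 + 2 * ρ) - 2 with he
  have he0 : e < 0 := by rw [he]; linarith
  set J : ℝ≥0∞ := ∫⁻ y in ball (0 : EuclideanSpace ℝ (Fin 3)) R, ‖u τ y‖ₑ ^ 2 with hJ
  -- ### admissibility for large `n`: `−τ < R² T^{n(1−2g)}`
  have hadm : ∀ᶠ n : ℕ in atTop, -τ < R ^ 2 * T ^ ((1 - 2 * g) * n) := by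
    have h1 : Tendsto (fun n : ℕ => (T ^ (1 - 2 * g)) ^ n) atTop atTop :=
      tendsto_pow_atTop_atTop_of_one_lt (Real.one_lt_rpow hT (by linarith))
    have h2 := (h1.const_mul_atTop (pow_pos hR 2)).eventually (eventually_gt_atTop (-τ))
    refine h2.mono fun n hn => ?_
    rwa [← Real.rpow_mul_natCast hT0.le] at hn
  -- ### the bound along the orbit
  have hbound : ∀ᶠ n : ℕ in atTop, J ≤ ENNReal.ofReal ((c : ℝ) * R ^ s * T ^ (e * n)) := by
    refine hadm.mono fun n hn => ?_
    have hθ : 0 < T ^ ((1 - g) * n) := Real.rpow_pos_of_pos hT0 _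
    have hℓ : 0 < T ^ (g * n) := Real.rpow_pos_of_pos hT0 _
    have hTn : 0 < T ^ n := pow_pos hT0 n
    set t : ℝ := (T ^ n)⁻¹ * τ with ht
    have ht0 : t < 0 := mul_neg_of_pos_of_neg (inv_pos.2 hTn) hτ
    set a : ℝ := (T ^ (g * n))⁻¹ * R with ha
    have ha0 : 0 < a := mul_pos (inv_pos.2 hℓ) hR
    -- admissibility `−a² < t`
    have hmem : t ∈ Ioo (-(a ^ 2)) 0 := by
      refine ⟨?_, ht0⟩
      -- `T^{(1−2g)n} = Tⁿ · ((T^{gn})²)⁻¹`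
      have hsplit : T ^ ((1 - 2 * g) * n) = T ^ n * ((T ^ (g * n)) ^ 2)⁻¹ := by
        rw [← Real.rpow_natCast (T ^ (g * n)) 2, ← Real.rpow_mul hT0.le, ← Real.rpow_neg hT0.le,
          ← Real.rpow_natCast T n, ← Real.rpow_add hT0]
        congr 1; push_cast; ring
      have hTn0 : (T : ℝ) ^ n ≠ 0 := hTn.ne'
      have ha2 : a ^ 2 = ((T ^ (g * n)) ^ 2)⁻¹ * R ^ 2 := by rw [ha, mul_pow, inv_pow]
      have h1 : (T ^ n)⁻¹ * (-τ) < a ^ 2 := by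
        rw [hsplit] at hn
        have h2 := mul_lt_mul_of_pos_left hn (inv_pos.2 hTn)
        have h3 : (T ^ n)⁻¹ * (R ^ 2 * (T ^ n * ((T ^ (g * n)) ^ 2)⁻¹)) = ((T ^ (g * n)) ^ 2)⁻¹ * R ^ 2 := by
          field_simp
        rw [ha2, ← h3]
        exact h2
      have h4 : (T ^ n)⁻¹ * (-τ) = -((T ^ n)⁻¹ * τ) := by ring
      rw [ht]; linarith
    -- the later slice `u t` on `B_a` is a rescaling of `u τ` on `B_R`
    have hfun : (fun y => ‖u t y‖ₑ ^ 2) =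
        fun y => ‖T ^ ((1 - g) * n) • u τ (((T ^ (g * n))⁻¹)⁻¹ • y)‖ₑ ^ 2 := by
      funext y; rw [inv_inv, ht, slice_later hT0 h n hτ y]
    have hgauge := hS a ha0 t hmem
    rw [hfun, PastShape.lintegral_ball_shape (inv_pos.2 hℓ) (u τ) a, inv_inv, clockFactor_eq hT0,
      show T ^ (g * n) * a = R by rw [ha, mul_inv_cancel_left₀ hℓ.ne']] at hgauge
    -- `hgauge : ofReal (T^{(2−5g)n}) * J ≤ ofReal (c a^s)`; divide
    have hX : 0 < T ^ ((2 - 5 * g) * n) := Real.rpow_pos_of_pos hT0 _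
    have hunit : ENNReal.ofReal (T ^ ((2 - 5 * g) * n))⁻¹ * ENNReal.ofReal (T ^ ((2 - 5 * g) * n)) = 1 := by
      rw [← ENNReal.ofReal_mul (inv_nonneg.2 hX.le), inv_mul_cancel₀ hX.ne', ENNReal.ofReal_one]
    have has : a ^ s = T ^ (-(g * n * s)) * R ^ s := by
      rw [ha, Real.mul_rpow (inv_nonneg.2 hℓ.le) hR.le, Real.inv_rpow hℓ.le, ← Real.rpow_neg (Real.rpow_nonneg hT0.le _),
        ← Real.rpow_mul hT0.le, mul_neg]
    calc J = ENNReal.ofReal (T ^ ((2 - 5 * g) * n))⁻¹ * (ENNReal.ofReal (T ^ ((2 - 5 * g) * n)) * J) := by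
          rw [← mul_assoc, hunit, one_mul]
      _ ≤ ENNReal.ofReal (T ^ ((2 - 5 * g) * n))⁻¹ * ENNReal.ofReal (c * a ^ s) := mul_le_mul_right hgauge _
      _ = ENNReal.ofReal ((c : ℝ) * R ^ s * T ^ (e * n)) := by
          rw [← ENNReal.ofReal_mul (inv_nonneg.2 hX.le), has, ← Real.rpow_neg hT0.le]
          congr 1
          have : T ^ (-((2 - 5 * g) * n)) * T ^ (-(g * n * s)) = T ^ (e * n) := by
            rw [← Real.rpow_add hT0]; congr 1; rw [he, hs]; ring
          calc T ^ (-((2 - 5 * g) * n)) * (c * (T ^ (-(g * n * s)) * R ^ s))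
              = c * R ^ s * (T ^ (-((2 - 5 * g) * n)) * T ^ (-(g * n * s))) := by ring
            _ = c * R ^ s * T ^ (e * n) := by rw [this]
  -- ### `n → ∞`
  have hlim : Tendsto (fun n : ℕ => ENNReal.ofReal ((c : ℝ) * R ^ s * T ^ (e * n))) atTop (𝓝 0) := by
    have h1 := (tendsto_rpow_mul_natCast_of_neg hT he0).const_mul ((c : ℝ) * R ^ s)
    rw [mul_zero] at h1
    have h2 := ENNReal.tendsto_ofReal h1
    rwa [ENNReal.ofReal_zero] at h2
  exact le_antisymm (ge_of_tendsto hlim hbound) bot_le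

/-! ### From balls to the whole space -/

/-- A lower integral over `ℝ³` vanishes if it vanishes on the balls `B_{n+1}` (countable subadditivity; no measurability). [folklore] -/
theorem lintegral_eq_zero_of_forall_ball {f : EuclideanSpace ℝ (Fin 3) → ℝ≥0∞}
    (hballs : ∀ n : ℕ, ∫⁻ x in ball (0 : EuclideanSpace ℝ (Fin 3)) ((n : ℝ) + 1), f x = 0) : ∫⁻ x, f x = 0 := by
  have hunion : (⋃ n : ℕ, ball (0 : EuclideanSpace ℝ (Fin 3)) ((n : ℝ) + 1)) = univ := by
    refine eq_univ_of_forall fun y => mem_iUnion.2 ?_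
    obtain ⟨n, hn⟩ := exists_nat_gt ‖y‖
    exact ⟨n, by rw [mem_ball, dist_zero_right]; linarith⟩
  refine le_antisymm ?_ zero_le
  calc ∫⁻ x, f x = ∫⁻ x in (⋃ n : ℕ, ball (0 : EuclideanSpace ℝ (Fin 3)) ((n : ℝ) + 1)), f x := by
        rw [hunion, Measure.restrict_univ]
    _ ≤ ∑' n : ℕ, ∫⁻ x in ball (0 : EuclideanSpace ℝ (Fin 3)) ((n : ℝ) + 1), f x := lintegral_iUnion_le _ _
    _ = 0 := by simp [hballs]

end DiscreteClock

end Summit.NavierStokesRegularity.NavierStokesRegularity.Theorems.PowerGaugeEulerLiouville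

end
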